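import Literature.Probability.LatticeModels.KCModifiedHMDecay
import HarnessLib

/-!
# Quadratic barriers next to a flat piece of the cut

Topic `Literature/Probability/LatticeModels`. The two "box lemmas" used in the proof of
Chelkak–Smirnov 2012, Theorem 6.1 (eqs. (6.9)–(6.10)) and Remark 6.3 at the points `u_int` one
lattice step inside the contour `C`:

* the UPPER bound `ω(u_int; ∂R_μ ∖ (pq); R_μ) = O(δ/μ)` (their Lemma 3.? "LemmaDhmR", from
  Chelkak–Smirnov 2011, Lemma 3.12), and
* the LOWER bound `V(u_int) ≥ const · δ` on the middle part of the contour,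

proved here on `ℤ²`, for any of the four orientations at once, by comparison with explicit
QUADRATIC lattice-harmonic polynomials in the frame coordinates `(b, t)` of the flat piece
(`b` = the coordinate along the inward normal `e_k`, `t` = the tangential coordinate): the functions
`α b + β t + γ (t² - b²) + c` are lattice-harmonic (second differences of quadratics are exact), the
barrier `M (2(b+1)/L + (t² - (b+1)²)/L²)` dominates a subharmonic `V ≤ M` vanishing on the flat
piece, and `m (b/(2H) - (t² - b²)/(4H²))` minorises a nonnegative superharmonic `V ≥ m` on the far
side. This replaces the rectangle harmonic measures of Chelkak–Smirnov 2011, Lemma 3.12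
(`RectangleSideHarmonicMeasure.lean`, one orientation) for the purposes of the sign-condition
argument (`KCModifiedDirichlet.lean`, `KCModifiedHMDecay.lean`).

Main statements (all `[folklore]` potential theory on `ℤ²`):

* `nCoord`, `tCoord` — frame coordinates; steps, the point `z₀ + e_k`, boxes (`mem_sqBox_iff_nCoord`);
* `flatHalfBox k z₀ h w = {1 ≤ b ≤ h, |t| ≤ w}`, its finiteness and outer boundary
  (`frame_of_mem_latticeOuterBoundary_flatHalfBox`);
* `latticeLaplacian_frameQuad` — `α b + β t + γ (t² - b²) + c` is lattice-harmonic;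
* **`le_of_subharmonicOn_flatHalfBox`** — `V(z₀ + e_k) ≤ 4M/(ℓ+2)` for `V` subharmonic on
  `flatHalfBox k z₀ ℓ ℓ`, `≤ 0` on the flat piece `{b = 0, |t| ≤ ℓ}` and `≤ M` on the rest of the frame;
* **`le_of_superharmonicOn_flatHalfBox`** — `V(z₀ + e_k) ≥ m/(2(h+1))` for `V ≥ 0` superharmonic on
  `flatHalfBox k z₀ h (2h+1)` and `≥ m` on the far side `{b = h+1}`;
* `rpow_sub_rpow_ge`, **`sum_rpow_sub_one_le`** — `∑_{i<n} (i+1)^{γ-1} ≤ n^γ/γ` (`0 < γ ≤ 1`), the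
  summation of the end estimate along the flat end of the contour.

## References

* D. Chelkak, S. Smirnov, Invent. Math. 189 (2012) = arXiv:0910.2045, proof of Thm. 6.1,
  eqs. (6.9)–(6.10), Remark 6.3 [ChelkakSmirnov2012Ising].
* D. Chelkak, S. Smirnov, Adv. Math. 228 (2011), Lemma 3.12 [ChelkakSmirnov2011].
-/

noncomputable section

open Finset Set

namespace Literature.Probability.LatticeModels

open WeakBeurling

/-! ### Frame coordinates of a flat piece -/

/-- The coordinate of `z - z₀` along the unit vector `e_k` (the inward normal of the flat piece). [folklore] -/
def nCoord (k : Fin 4) (z₀ z : Site 2) : ℤ := (z 0 - z₀ 0) * cornerUnit k 0 + (z 1 - z₀ 1) * cornerUnit k 1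

/-- The coordinate of `z - z₀` along `e_k` rotated by `+90°` (the tangent of the flat piece). [folklore] -/
def tCoord (k : Fin 4) (z₀ z : Site 2) : ℤ := (z 1 - z₀ 1) * cornerUnit k 0 - (z 0 - z₀ 0) * cornerUnit k 1

/-- The normal component of the unit step `e_m`. [folklore] -/
def nStep (k m : Fin 4) : ℤ := cornerUnit m 0 * cornerUnit k 0 + cornerUnit m 1 * cornerUnit k 1

/-- The tangential component of the unit step `e_m`. [folklore] -/
def tStep (k m : Fin 4) : ℤ := cornerUnit m 1 * cornerUnit k 0 - cornerUnit m 0 * cornerUnit k 1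

/-- The base point has normal coordinate `0`. [folklore] -/
@[simp] theorem nCoord_self (k : Fin 4) (z₀ : Site 2) : nCoord k z₀ z₀ = 0 := by simp [nCoord]

/-- The base point has tangential coordinate `0`. [folklore] -/
@[simp] theorem tCoord_self (k : Fin 4) (z₀ : Site 2) : tCoord k z₀ z₀ = 0 := by simp [tCoord]

/-- A unit step changes the normal coordinate by `nStep`. [folklore] -/
theorem nCoord_add_cornerUnit (k : Fin 4) (z₀ z : Site 2) (m : Fin 4) :
    nCoord k z₀ (z + cornerUnit m) = nCoord k z₀ z + nStep k m := by
  simp only [nCoord, nStep, Pi.add_apply]; ring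

/-- A unit step changes the tangential coordinate by `tStep`. [folklore] -/
theorem tCoord_add_cornerUnit (k : Fin 4) (z₀ z : Site 2) (m : Fin 4) :
    tCoord k z₀ (z + cornerUnit m) = tCoord k z₀ z + tStep k m := by
  simp only [tCoord, tStep, Pi.add_apply]; ring

/-- A unit step changes exactly one frame coordinate, by `±1`. [folklore] -/
theorem nStep_tStep (k m : Fin 4) :
    ((nStep k m = 1 ∨ nStep k m = -1) ∧ tStep k m = 0) ∨ (nStep k m = 0 ∧ (tStep k m = 1 ∨ tStep k m = -1)) := by
  fin_cases k <;> fin_cases m <;> simp [nStep, tStep]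

/-- The sums of the step components vanish and their squares sum to `2`. [folklore] -/
theorem nStep_tStep_sums (k : Fin 4) :
    (∑ m : Fin 4, (nStep k m : ℝ)) = 0 ∧ (∑ m : Fin 4, (tStep k m : ℝ)) = 0 ∧
      (∑ m : Fin 4, (nStep k m : ℝ) ^ 2) = 2 ∧ (∑ m : Fin 4, (tStep k m : ℝ) ^ 2) = 2 := by
  fin_cases k <;> simp [nStep, tStep, Fin.sum_univ_four] <;> norm_num

/-- The point one step inside: `b = 1`, `t = 0`. [folklore] -/
theorem frame_add_cornerUnit_self (k : Fin 4) (z₀ : Site 2) :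
    nCoord k z₀ (z₀ + cornerUnit k) = 1 ∧ tCoord k z₀ (z₀ + cornerUnit k) = 0 := by
  rw [nCoord_add_cornerUnit, tCoord_add_cornerUnit, nCoord_self, tCoord_self]
  fin_cases k <;> simp [nStep, tStep]

/-- Boxes in frame coordinates: `z ∈ sqBox z₀ n ↔ |b| ≤ n ∧ |t| ≤ n`. [folklore] -/
theorem mem_sqBox_iff_nCoord (k : Fin 4) (z₀ z : Site 2) (n : ℤ) :
    z ∈ sqBox z₀ n ↔ |nCoord k z₀ z| ≤ n ∧ |tCoord k z₀ z| ≤ n := by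
  rw [mem_sqBox, abs_le, abs_le, abs_le, abs_le]
  fin_cases k <;> simp [nCoord, tCoord] <;> omega

/-! ### Half-boxes over a flat piece -/

/-- The half-box `{1 ≤ b ≤ h, |t| ≤ w}` over the flat piece `{b = 0}` through `z₀`. [folklore] -/
def flatHalfBox (k : Fin 4) (z₀ : Site 2) (h w : ℕ) : Set (Site 2) :=
  {z | 1 ≤ nCoord k z₀ z ∧ nCoord k z₀ z ≤ h ∧ |tCoord k z₀ z| ≤ w}

/-- The half-box lies in `sqBox z₀ (h + w)`. [folklore] -/
theorem flatHalfBox_subset_sqBox (k : Fin 4) (z₀ : Site 2) (h w : ℕ) : flatHalfBox k z₀ h w ⊆ sqBox z₀ ((h : ℤ) + w) := by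
  intro z hz
  obtain ⟨h1, h2, h3⟩ := hz
  rw [mem_sqBox_iff_nCoord k, abs_le, abs_le]
  rw [abs_le] at h3
  omega

/-- The half-box is finite. [folklore] -/
theorem flatHalfBox_finite (k : Fin 4) (z₀ : Site 2) (h w : ℕ) : (flatHalfBox k z₀ h w).Finite :=
  (sqBox_finite z₀ _).subset (flatHalfBox_subset_sqBox k z₀ h w)

/-- The point one step inside lies in the half-box (`1 ≤ h`). [folklore] -/
theorem add_cornerUnit_mem_flatHalfBox (k : Fin 4) (z₀ : Site 2) {h : ℕ} (hh : 1 ≤ h) (w : ℕ) :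
    z₀ + cornerUnit k ∈ flatHalfBox k z₀ h w := by
  obtain ⟨h1, h2⟩ := frame_add_cornerUnit_self k z₀
  refine ⟨by omega, by omega, ?_⟩
  rw [h2, abs_zero]; exact_mod_cast Nat.zero_le w

/-- **The outer boundary of the half-box**: the flat piece `{b = 0, |t| ≤ w}`, the far side
`{b = h+1, |t| ≤ w}` and the lateral sides `{|t| = w+1, 1 ≤ b ≤ h}`. [folklore] -/
theorem frame_of_mem_latticeOuterBoundary_flatHalfBox {k : Fin 4} {z₀ : Site 2} {h w : ℕ} {z : Site 2}
    (hz : z ∈ latticeOuterBoundary (flatHalfBox k z₀ h w)) :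
    (nCoord k z₀ z = 0 ∧ |tCoord k z₀ z| ≤ w) ∨ (nCoord k z₀ z = h + 1 ∧ |tCoord k z₀ z| ≤ w) ∨
      (|tCoord k z₀ z| = w + 1 ∧ 1 ≤ nCoord k z₀ z ∧ nCoord k z₀ z ≤ h) := by
  obtain ⟨hzW, v, ⟨h1, h2, h3⟩, m, rfl⟩ := hz
  simp only [flatHalfBox, Set.mem_setOf_eq, nCoord_add_cornerUnit, tCoord_add_cornerUnit, abs_le, not_and, not_le] at hzW
  rw [nCoord_add_cornerUnit, tCoord_add_cornerUnit, abs_le, abs_eq (by positivity : (0 : ℤ) ≤ (w : ℤ) + 1)]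
  rw [abs_le] at h3
  rcases nStep_tStep k m with ⟨hn | hn, ht⟩ | ⟨hn, ht | ht⟩ <;> rw [hn, ht] at hzW ⊢
  · -- `b' = b + 1 ≤ h + 1`, `t' = t`
    rcases eq_or_lt_of_le (show nCoord k z₀ v + 1 ≤ (h : ℤ) + 1 by omega) with heq | hlt
    · exact Or.inr (Or.inl ⟨heq, by omega⟩)
    · exact absurd (hzW (by omega) (by omega) (by omega)) (by omega)
  · -- `b' = b - 1 ≥ 0`
    rcases eq_or_lt_of_le (show (0 : ℤ) ≤ nCoord k z₀ v + -1 by omega) with heq | hlt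
    · exact Or.inl ⟨heq.symm, by omega⟩
    · exact absurd (hzW (by omega) (by omega) (by omega)) (by omega)
  · -- `t' = t + 1`
    right; right
    refine ⟨?_, by omega, by omega⟩
    have := hzW (by omega) (by omega) (by omega)
    omega
  · right; right
    refine ⟨?_, by omega, by omega⟩
    rcases le_or_gt (-(w : ℤ)) (tCoord k z₀ v + -1) with hc | hc
    · have := hzW (by omega) (by omega) hc
      omega
    · omega

/-! ### Lattice-harmonic quadratics in frame coordinates -/

/-- **Frame quadratics are lattice-harmonic**: for all real `α, β, γ, c`, the function
`α b + β t + γ (t² - b²) + c` of the frame coordinates has vanishing lattice Laplacian (its second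
differences along `e_k` and along the tangent are `∓ 2γ`). [folklore] -/
theorem latticeLaplacian_frameQuad (k : Fin 4) (z₀ : Site 2) (α β γ c : ℝ) (v : Site 2) :
    latticeLaplacian (fun z => α * nCoord k z₀ z + β * tCoord k z₀ z +
      γ * ((tCoord k z₀ z : ℝ) ^ 2 - (nCoord k z₀ z : ℝ) ^ 2) + c) v = 0 := by
  obtain ⟨hs1, hs2, hs3, hs4⟩ := nStep_tStep_sums k
  rw [Fin.sum_univ_four] at hs1 hs2 hs3 hs4
  rw [latticeLaplacian_eq, Fin.sum_univ_four]
  simp only [nCoord_add_cornerUnit, tCoord_add_cornerUnit]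
  push_cast
  set b : ℝ := (nCoord k z₀ v : ℝ)
  set t : ℝ := (tCoord k z₀ v : ℝ)
  linear_combination (α - 2 * γ * b) * hs1 + (β + 2 * γ * t) * hs2 - γ * hs3 + γ * hs4

/-! ### The upper barrier: a subharmonic function vanishing on the flat piece -/

/-- **Upper box lemma by a quadratic barrier.** Let `V` be subharmonic on the half-box
`{1 ≤ b ≤ ℓ, |t| ≤ ℓ}` over the flat piece through `z₀` (inward normal `e_k`), `V ≤ 0` on the flat
piece `{b = 0, |t| ≤ ℓ}` and `V ≤ M` (`M ≥ 0`) at the other points of `sqBox z₀ (ℓ+1)` with `b ≥ 1`.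
Then one step inside, `V (z₀ + e_k) ≤ 4M/(ℓ+2)`: compare with the lattice-harmonic
`M (2(b+1)/L + (t² - (b+1)²)/L²)`, `L = ℓ + 2`, which is `≥ 0` on the flat piece and `≥ M` on the
rest of the frame (Chelkak–Smirnov's `ω(u_int; ∂R_μ ∖ (pq); R_μ) = O(δ/μ)`).
[cite: ChelkakSmirnov2012Ising, proof of Thm. 6.1, eq. (6.9); ChelkakSmirnov2011, Lemma 3.12] -/
theorem le_of_subharmonicOn_flatHalfBox (k : Fin 4) (z₀ : Site 2) {ℓ : ℕ} (hℓ : 1 ≤ ℓ) {V : Site 2 → ℝ} {M : ℝ}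
    (hM : 0 ≤ M) (hsub : IsLatticeSubharmonicOn V (flatHalfBox k z₀ ℓ ℓ))
    (hflat : ∀ z, nCoord k z₀ z = 0 → |tCoord k z₀ z| ≤ ℓ → V z ≤ 0)
    (hfar : ∀ z ∈ sqBox z₀ ((ℓ : ℤ) + 1), 1 ≤ nCoord k z₀ z → V z ≤ M) :
    V (z₀ + cornerUnit k) ≤ 4 * M / ((ℓ : ℝ) + 2) := by
  set L : ℝ := (ℓ : ℝ) + 2 with hL
  have hL0 : 0 < L := by positivity
  set G : Site 2 → ℝ := fun z => M * (2 * ((nCoord k z₀ z : ℝ) + 1) / L +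
    ((tCoord k z₀ z : ℝ) ^ 2 - ((nCoord k z₀ z : ℝ) + 1) ^ 2) / L ^ 2) with hG
  have hGh : ∀ v, latticeLaplacian G v = 0 := by
    intro v
    have e : G = fun z => (M * (2 / L - 2 / L ^ 2)) * nCoord k z₀ z + 0 * tCoord k z₀ z +
        (M / L ^ 2) * ((tCoord k z₀ z : ℝ) ^ 2 - (nCoord k z₀ z : ℝ) ^ 2) + M * (2 / L - 1 / L ^ 2) := by
      funext z; simp only [hG]; field_simp; ring
    rw [e]; exact latticeLaplacian_frameQuad k z₀ _ _ _ _ v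
  have hfin := flatHalfBox_finite k z₀ ℓ ℓ
  have key := le_of_sub_super_of_boundary hfin hsub (fun v _ => (hGh v).le) (c := 0) ?_ (z₀ + cornerUnit k)
    (add_cornerUnit_mem_flatHalfBox k z₀ hℓ ℓ)
  · obtain ⟨hb1, ht0⟩ := frame_add_cornerUnit_self k z₀
    rw [add_zero] at key
    refine key.trans ?_
    simp only [hG, hb1, ht0]
    push_cast
    have : M * (2 * (1 + 1) / L + (0 ^ 2 - (1 + 1) ^ 2) / L ^ 2) = 4 * M / L - 4 * M / L ^ 2 := by
      field_simp; ring
    rw [this]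
    have : 0 ≤ 4 * M / L ^ 2 := by positivity
    linarith
  · intro z hz
    rw [add_zero]
    rcases frame_of_mem_latticeOuterBoundary_flatHalfBox hz with ⟨hb, ht⟩ | ⟨hb, ht⟩ | ⟨ht, hb1, hb2⟩
    · -- the flat piece: `V ≤ 0 ≤ G`
      refine (hflat z hb ht).trans ?_
      simp only [hG, hb]
      push_cast
      have ht' : ((tCoord k z₀ z : ℝ)) ^ 2 ≥ 0 := sq_nonneg _
      have : M * (2 * (0 + 1) / L + ((tCoord k z₀ z : ℝ) ^ 2 - (0 + 1) ^ 2) / L ^ 2) =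
          M * ((2 * L - 1) / L ^ 2) + M * ((tCoord k z₀ z : ℝ) ^ 2 / L ^ 2) := by
        field_simp; ring
      rw [this]
      have hL1 : (1 : ℝ) ≤ L := by simp only [hL]; linarith [(Nat.cast_nonneg ℓ : (0 : ℝ) ≤ ℓ)]
      have h1 : 0 ≤ (2 * L - 1) / L ^ 2 := div_nonneg (by linarith) (by positivity)
      exact add_nonneg (mul_nonneg hM h1) (by positivity)
    · -- the far side: `V ≤ M ≤ G`
      have hzbox : z ∈ sqBox z₀ ((ℓ : ℤ) + 1) := by
        rw [mem_sqBox_iff_nCoord k, hb, abs_le, abs_le]; rw [abs_le] at ht; omega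
      refine (hfar z hzbox (by rw [hb]; omega)).trans ?_
      simp only [hG, hb]
      push_cast
      have : M * (2 * ((ℓ : ℝ) + 1 + 1) / L + ((tCoord k z₀ z : ℝ) ^ 2 - ((ℓ : ℝ) + 1 + 1) ^ 2) / L ^ 2) =
          M + M * ((tCoord k z₀ z : ℝ) ^ 2 / L ^ 2) := by
        simp only [hL]; field_simp; ring
      rw [this]
      have : 0 ≤ M * ((tCoord k z₀ z : ℝ) ^ 2 / L ^ 2) := by positivity
      linarith
    · -- the lateral sides: `V ≤ M ≤ G`
      have hzbox : z ∈ sqBox z₀ ((ℓ : ℤ) + 1) := by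
        rw [mem_sqBox_iff_nCoord k, ht, abs_le]; omega
      refine (hfar z hzbox hb1).trans ?_
      simp only [hG]
      have hx1 : (2 : ℝ) ≤ (nCoord k z₀ z : ℝ) + 1 := by
        have : (1 : ℝ) ≤ (nCoord k z₀ z : ℝ) := by exact_mod_cast hb1
        linarith
      have hx2 : (nCoord k z₀ z : ℝ) + 1 ≤ (ℓ : ℝ) + 1 := by
        have : (nCoord k z₀ z : ℝ) ≤ (ℓ : ℝ) := by exact_mod_cast hb2
        linarith
      have htsq : ((tCoord k z₀ z : ℝ)) ^ 2 = ((ℓ : ℝ) + 1) ^ 2 := by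
        have h' : (|tCoord k z₀ z| : ℝ) = (ℓ : ℝ) + 1 := by exact_mod_cast ht
        rw [← sq_abs, h']
      rw [htsq]
      set x : ℝ := (nCoord k z₀ z : ℝ) + 1 with hx
      have hℓ1 : (1 : ℝ) ≤ ℓ := by exact_mod_cast hℓ
      -- `M ≤ M (2x/L + ((ℓ+1)² - x²)/L²)` iff `L² ≤ 2xL + (ℓ+1)² - x²`, i.e. `0 ≤ xℓ + x - 1 + (x-2)(ℓ+1-x)`
      have hpoly : L ^ 2 ≤ 2 * x * L + ((ℓ : ℝ) + 1) ^ 2 - x ^ 2 := by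
        simp only [hL]; nlinarith [mul_nonneg (sub_nonneg.2 hx1) (sub_nonneg.2 hx2)]
      have : M * 1 ≤ M * (2 * x / L + (((ℓ : ℝ) + 1) ^ 2 - x ^ 2) / L ^ 2) := by
        apply mul_le_mul_of_nonneg_left _ hM
        rw [div_add_div _ _ hL0.ne' (by positivity), le_div_iff₀ (by positivity)]
        nlinarith
      linarith

/-! ### The lower barrier: a nonnegative superharmonic function large on the far side -/

/-- **Lower box lemma by a quadratic barrier.** Let `V ≥ 0` be superharmonic on the half-box
`{1 ≤ b ≤ h, |t| ≤ 2h+1}` over the flat piece through `z₀` (inward normal `e_k`) and `V ≥ m ≥ 0` on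
the far side `{b = h+1, |t| ≤ 2h+1}`. Then one step inside, `V (z₀ + e_k) ≥ m/(2(h+1))`: compare
with the lattice-harmonic `m (b/(2H) - (t² - b²)/(4H²))`, `H = h + 1`, which is `≤ 0` on the flat
piece and the lateral sides and `≤ m` on the far side (Chelkak–Smirnov's
`V(u_int) ≥ const · δ` on the middle of the contour). [cite: ChelkakSmirnov2012Ising, proof of Thm. 6.1, eq. (6.9); ChelkakSmirnov2011, Lemma 3.12] -/
theorem le_of_superharmonicOn_flatHalfBox (k : Fin 4) (z₀ : Site 2) {h : ℕ} (hh : 1 ≤ h) {V : Site 2 → ℝ} {m : ℝ}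
    (hm : 0 ≤ m) (hsup : IsLatticeSuperharmonicOn V (flatHalfBox k z₀ h (2 * h + 1)))
    (hnn : ∀ z, 0 ≤ V z)
    (hfar : ∀ z, nCoord k z₀ z = h + 1 → |tCoord k z₀ z| ≤ 2 * h + 1 → m ≤ V z) :
    m / (2 * ((h : ℝ) + 1)) ≤ V (z₀ + cornerUnit k) := by
  set H : ℝ := (h : ℝ) + 1 with hH
  have hH0 : 0 < H := by positivity
  set g : Site 2 → ℝ := fun z => m * ((nCoord k z₀ z : ℝ) / (2 * H) -
    ((tCoord k z₀ z : ℝ) ^ 2 - (nCoord k z₀ z : ℝ) ^ 2) / (4 * H ^ 2)) with hg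
  have hgh : ∀ v, latticeLaplacian g v = 0 := by
    intro v
    have e : g = fun z => (m / (2 * H)) * nCoord k z₀ z + 0 * tCoord k z₀ z +
        (-(m / (4 * H ^ 2))) * ((tCoord k z₀ z : ℝ) ^ 2 - (nCoord k z₀ z : ℝ) ^ 2) + 0 := by
      funext z; simp only [hg]; ring
    rw [e]; exact latticeLaplacian_frameQuad k z₀ _ _ _ _ v
  have hfin := flatHalfBox_finite k z₀ h (2 * h + 1)
  have key := le_of_sub_super_of_boundary hfin (fun v _ => (hgh v).ge) hsup (c := 0) ?_ (z₀ + cornerUnit k)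
    (add_cornerUnit_mem_flatHalfBox k z₀ hh _)
  · obtain ⟨hb1, ht0⟩ := frame_add_cornerUnit_self k z₀
    rw [add_zero] at key
    refine le_trans ?_ key
    simp only [hg, hb1, ht0]
    push_cast
    have : m * (1 / (2 * H) - (0 ^ 2 - 1 ^ 2) / (4 * H ^ 2)) = m / (2 * H) + m / (4 * H ^ 2) := by
      field_simp; ring
    rw [this]
    have : 0 ≤ m / (4 * H ^ 2) := by positivity
    linarith
  · intro z hz
    rw [add_zero]
    rcases frame_of_mem_latticeOuterBoundary_flatHalfBox hz with ⟨hb, ht⟩ | ⟨hb, ht⟩ | ⟨ht, hb1, hb2⟩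
    · -- flat piece: `g = -m t²/(4H²) ≤ 0 ≤ V`
      refine le_trans ?_ (hnn z)
      simp only [hg, hb]
      push_cast
      have : m * (0 / (2 * H) - ((tCoord k z₀ z : ℝ) ^ 2 - 0 ^ 2) / (4 * H ^ 2)) =
          -(m * ((tCoord k z₀ z : ℝ) ^ 2 / (4 * H ^ 2))) := by ring
      rw [this, neg_nonpos]
      positivity
    · -- far side: `g ≤ 3m/4 ≤ m ≤ V`
      refine le_trans ?_ (hfar z hb ht)
      simp only [hg, hb]
      push_cast
      simp only [← hH]
      have : m * (H / (2 * H) - ((tCoord k z₀ z : ℝ) ^ 2 - H ^ 2) / (4 * H ^ 2)) =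
          m * (3 / 4) - m * ((tCoord k z₀ z : ℝ) ^ 2 / (4 * H ^ 2)) := by
        field_simp; ring
      rw [this]
      have : 0 ≤ m * ((tCoord k z₀ z : ℝ) ^ 2 / (4 * H ^ 2)) := by positivity
      linarith
    · -- lateral sides: `g ≤ m (1/2 - 1 + 1/4) ≤ 0 ≤ V`
      refine le_trans ?_ (hnn z)
      simp only [hg]
      have htsq : ((tCoord k z₀ z : ℝ)) ^ 2 = (2 * H) ^ 2 := by
        have h' : (|tCoord k z₀ z| : ℝ) = 2 * (h : ℝ) + 1 + 1 := by exact_mod_cast ht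
        rw [← sq_abs, h', hH]; ring
      rw [htsq]
      have hb0 : (0 : ℝ) ≤ (nCoord k z₀ z : ℝ) := by exact_mod_cast (show (0 : ℤ) ≤ nCoord k z₀ z by omega)
      have hbH : (nCoord k z₀ z : ℝ) ≤ H := by
        have : (nCoord k z₀ z : ℝ) ≤ (h : ℝ) := by exact_mod_cast hb2
        simp only [hH]; linarith
      set x : ℝ := (nCoord k z₀ z : ℝ)
      have h1 : x / (2 * H) ≤ 1 / 2 := by
        rw [div_le_iff₀ (by positivity)]; linarith
      have h2 : ((2 * H) ^ 2 - x ^ 2) / (4 * H ^ 2) ≥ 3 / 4 := by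
        rw [ge_iff_le, le_div_iff₀ (by positivity)]; nlinarith
      have : x / (2 * H) - ((2 * H) ^ 2 - x ^ 2) / (4 * H ^ 2) ≤ 0 := by linarith
      exact mul_nonpos_of_nonneg_of_nonpos hm this |>.trans (le_refl 0)

/-! ### The summation of the end estimate -/

/-- `γ x^{γ-1} ≤ x^γ - (x-1)^γ` for `x ≥ 1`, `0 < γ ≤ 1` (Bernoulli). [folklore] -/
theorem rpow_sub_rpow_ge {γ : ℝ} (hγ0 : 0 < γ) (hγ1 : γ ≤ 1) {x : ℝ} (hx : 1 ≤ x) :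
    γ * x ^ (γ - 1) ≤ x ^ γ - (x - 1) ^ γ := by
  have hx0 : 0 < x := by linarith
  have hB := rpow_one_add_le_one_add_mul_self (show (-1 : ℝ) ≤ -(1 / x) by
    rw [neg_le_neg_iff, div_le_one hx0]; exact hx) hγ0.le hγ1
  -- `(x-1)^γ = x^γ (1 - 1/x)^γ ≤ x^γ (1 - γ/x) = x^γ - γ x^{γ-1}`
  have e1 : (x - 1) ^ γ = x ^ γ * (1 + -(1 / x)) ^ γ := by
    rw [← Real.mul_rpow hx0.le (by rw [← sub_eq_add_neg, sub_nonneg, div_le_one hx0]; exact hx),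
      mul_add, mul_one, mul_neg, mul_one_div_cancel hx0.ne', ← sub_eq_add_neg]
  have e2 : x ^ (γ - 1) = x ^ γ * (1 / x) := by
    rw [Real.rpow_sub_one hx0.ne']; ring
  rw [e1, e2]
  have hxγ : 0 ≤ x ^ γ := Real.rpow_nonneg hx0.le _
  nlinarith [mul_le_mul_of_nonneg_left hB hxγ]

/-- **Summation of the end estimate**: `∑_{i<n} (i+1)^{γ-1} ≤ n^γ/γ` for `0 < γ ≤ 1`. [folklore] -/
theorem sum_rpow_sub_one_le {γ : ℝ} (hγ0 : 0 < γ) (hγ1 : γ ≤ 1) (n : ℕ) :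
    ∑ i ∈ Finset.range n, ((i : ℝ) + 1) ^ (γ - 1) ≤ (n : ℝ) ^ γ / γ := by
  rw [le_div_iff₀ hγ0, Finset.sum_mul]
  have hstep : ∀ i ∈ Finset.range n, ((i : ℝ) + 1) ^ (γ - 1) * γ ≤ ((i : ℝ) + 1) ^ γ - (i : ℝ) ^ γ := by
    intro i _
    have := rpow_sub_rpow_ge hγ0 hγ1 (show (1 : ℝ) ≤ (i : ℝ) + 1 by have := (Nat.cast_nonneg i : (0:ℝ) ≤ i); linarith)
    rw [add_sub_cancel_right] at this
    linarith
  refine (Finset.sum_le_sum hstep).trans ?_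
  have htel : ∑ i ∈ Finset.range n, (((i : ℝ) + 1) ^ γ - (i : ℝ) ^ γ) = (n : ℝ) ^ γ - (0 : ℝ) ^ γ := by
    have := Finset.sum_range_sub (fun i : ℕ => ((i : ℝ)) ^ γ) n
    simpa using this
  rw [htel, Real.zero_rpow hγ0.ne', sub_zero]

end Literature.Probability.LatticeModels
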